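import Summits.QuantumFields.YangMills.Theorems.UnitScaleGibbsChartPullbackBianchi
import Summits.QuantumFields.YangMills.Theorems.CovariantDischargeTruncatedPotentialPairing
import Summits.QuantumFields.YangMills.Theorems.GrossTransferPauliReadField
import Summits.QuantumFields.YangMills.Theorems.UnitScaleGibbsOnEventHessianAxialGauge
import HarnessLib

/-!
# `GrossTransferStubLinTestBianchiTerm` — KNIT-E3 (R8-P6): THE BIANCHI TERM OF `stub_linTest`'s POINTWISE PACKAGE, ONE REAL INEQUALITY
# (LINE 28 «GrossTransfer» v3.2, skeleton of record `Cruxes/HistoryTailL/Lines/gross_transfer.lean`; crux `RevelationMartingale.MeanDeviationL`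
# stmt-QuantumFields-23083 ∕ `UnitScaleTilt.HistoryTailL` stmt-QuantumFields-19936)

Cell `ym3-torus` (YM ladder rung R3 = continuum SU(2) Yang–Mills on T³ — a RUNG, NOT the Clay problem: not d = 4, not infinite volume, not a
mass gap); width seat `ym3-torus-px13` (gen 12), helper `--supports stmt-QuantumFields-23083` for the pen of record ★w2-19936 (KNIT-PLAN v3,
23083 evidence #19, row (P6) «Bianchi: KNIT-E3 over ✓`GrossTransferPauliReadField` + ✓KNIT-A∕C + ✓(Z-a) `sum_mul_dTwo_eq_three_mul` + ✓`bulk_mass_le`»;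
norm-scope rule: P5∕P6∕P7 as separate `Matrix.Norms.L2Operator`-scoped files exporting REAL inequalities, the Frobenius-scoped package only combines).
THEOREMS ONLY (0 `def`, 0 `sorry`, default heartbeats).

WHAT.  In the pen's `main_estimate` the (Z-e) cutoff-potential identity (P4) ✓`CovariantDischargeTruncatedPotentialPairing.sum_curl_truncated_mul_eq` leaves
the BIANCHI (bulk) TERM `Σ_{y∈Q_{3R+2}(z₀)} Σ_κ Σ_μ Σ_ν (χ(y)·γ̃(y,κ,μ,ν))·(F̂^α(y+e_κ,μ,ν) − F̂^α(y,μ,ν))`, where `γ̃ = d₂β̃` is the cube derivative of the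
(antisymmetric) Green potential `β̃`, `χ ∈ [0,1]` the smooth cutoff vanishing off `Q_{3R}(z₀)`, and `F̂^α` the antisymmetrised Pauli read-out of the dressed
plaquette variables `F^α_p = Re tr((iσ_α)(V(∂p) − 1))`, `V = U^{axialGauge U lo hi}`.  Since `χγ̃` is a totally antisymmetric 3-form, the pairing with `∇F̂`
is one third of the pairing with the alternating cube derivative `d₂F̂` (✓(Z-a) `CovariantDischargeLatticeFormsDeg23.sum_mul_dTwo_eq_three_mul`, packaged with
the cutoff as ✓`CovariantDischargeTruncatedPotentialPairing.abs_bulk_le`), and `d₂F̂` is the READ lattice Bianchi defect: for the units pullback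
`V̂(y,κ) = ↑V⟨castSite y, κ⟩ ∈ (M₂(ℂ))ˣ` one has `F̂^α(y,μ,ν) = λ_α(V̂(∂p_{μν}(y)) − 1)` at EVERY index pair (`μ < ν` by the plaquette dictionary
✓`T4AxialGaugeSmallField.hol_pull_plaqWord_of_lt`, `ν < μ` by ✓`hol_pull_plaqWord_of_gt` + ✓`GrossTransferPauliReadField.re_trace_pauli_mul_inv_sub_one`,
`μ = ν` trivially), with `λ_α` the Pauli reading functional of ✓`GrossTransferPauliReadField.exists_pauliRead` (`‖λ_α‖ ≤ 4`), so ✓KNIT-A∕C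
`UnitScaleGibbsChartPullbackBianchi.abs_dTwo_read_le_on_box` gives `|d₂F̂^α| ≤ 4·984·η²` on `Q_{S−2}(z)` from bond smallness `‖↑V⟨castSite x,κ⟩ − 1‖ ≤ η`,
`4η ≤ 1`, on `Q_S(z)` alone.  Hence:
* §1 ★`exists_unitsPull` — the units pullback with its value row, `U1` row and the three plaquette-dictionary rows (`μ < ν`, `ν < μ`, `μ = μ`);
* §2 ★`readout_eq_read_plaqF` — `F̂^α = λ_α(F^{plaq}V̂ − 1)` at all index pairs from the pen's two rows (`μ < ν` row + antisymmetry);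
* §3 ★★`bianchi_term_le` — SUPPORT-AGNOSTIC edition (any `SU(2)` field `V`, any centre `z`, radii `S`, `R′ ≥ S − 2`, smallness only on `Q_S(z)`):
  `|Σ_{Q_{R′}}ΣΣΣ (χγ̃)·∇F̂^α| ≤ 1312·η²·Σ_{Q_{S−2}}ΣΣΣ|γ̃|` (`1312 = 4·984∕3`);
* §4 ★★★`bianchi_term_le_of_letters` — THE PEN's CONTEXT (`PlaqSmallOn (boxPlaqs lo hi) θ U`, `hi ≤ lo + n`, `n < sitesPerDir`, `lo = z₀ − (3R+2)`,
  `hi = z₀ + (3R+4)`, `V := U^{axialGauge U lo hi}`, `S := 3R+2`, `η := (d−1)·n·θ` with `4η ≤ 1` by ✓`norm_gaugeAct_axialGauge_sub_one_le`; `χ = 0` off `Q_{3R}(z₀)`):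
  `|Σ_{y∈Q_{3R+2}(z₀)}ΣΣΣ (χγ̃)·∇F̂^α| ≤ 1312·((d−1)nθ)²·Σ_{Q_{3R}(z₀)}ΣΣΣ|γ̃|`, binders = the skeleton's `hγt`∕`hχ01`∕`hχ0'` TOKEN FOR TOKEN plus `hβanti`
  (the Z3-style antisymmetry of `βt`), and a closer `bianchi_term_le_of_letters_of_mass` taking the (Z-e) bulk-mass row `Σ_{Q_{3R}}|γ̃| ≤ Mγ` (✓`bulk_mass_le`, `d = 3`)
  as a hypothesis.

HONEST SCOPE.  Deterministic `2 × 2`-matrix ∕ finite-sum algebra about ONE configuration; proves no stub: `stub_linTest`, its pointwise package,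
`stub_meanDeviationDeep`, `MeanDeviationL` 23083, `MeanDeviationDeepL` 23134, `HistoryTailL` 19936, K1∕K2, the rung `YM3TorusSU2` are NOT proved; no summit
statement is proved; the Yang–Mills mass gap is NOT proved.
References: [GrossCMP1983] Thm 2.2 (convergence of lattice gauge theory observables via summation by parts — the Bianchi∕bulk bookkeeping);
[Balaban1985Averaging] (9) p. 18, (19)–(20) p. 21 (plaquette variables, `dist₁` and the small-field bond letters); [Balaban1985RegularSpaces] (1.2) p. 76
(the plaquette field `F_{μν}(x)`).
-/

noncomputable section

set_option autoImplicit false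

open scoped BigOperators Matrix.Norms.L2Operator
open Complex Finset
open Literature.MathematicalPhysics.QuantumFieldTheory.Balaban1983to89
open Literature.MathematicalPhysics.QuantumFieldTheory.Balaban1983to89.B4Eq19LatticeOperators (Zd unitVec box mem_box box_mono add_unitVec_mem_box
  abs_unitVec_apply_le)
open Literature.MathematicalPhysics.QuantumFieldTheory.Balaban1983to89.T4AxialGaugeSmallField (castSite castSite_add_e boxPlaqs boxBonds axialGauge pull
  pull_apply hol_pull_plaqWord_of_lt hol_pull_plaqWord_of_gt)
open Literature.MathematicalPhysics.QuantumFieldTheory.Balaban1983to89.B7Prop1Explicit (e hol plaqWord stepHol U1 Letter)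
open Literature.MathematicalPhysics.QuantumFieldTheory.Balaban1983to89.B10Eq18SigmaSU2 (pauli)
open Literature.MathematicalPhysics.QuantumFieldTheory.Balaban1983to89.B10Eq27TorusAxialLog (suIncl)
open B8Ineq132 (plaqF)
open Summit.QuantumFields.YangMills.Theorems.GrossTransferPauliReadField (exists_pauliRead re_trace_pauli_mul_inv_sub_one)
open Summit.QuantumFields.YangMills.Theorems.UnitScaleGibbsChartPullbackBianchi (abs_dTwo_read_le_on_box mem_U1_of_val_eq_coe)
open Summit.QuantumFields.YangMills.Theorems.CovariantDischargeTruncatedPotentialPairing (abs_bulk_le)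
open Summit.QuantumFields.YangMills.Theorems.UnitScaleGibbsOnEventHessianAxialGauge (norm_gaugeAct_axialGauge_sub_one_le)

namespace Summit.QuantumFields.YangMills.Theorems.GrossTransferStubLinTestBianchiTerm

variable {P : Params} {j : ℕ}

/-! ## §1 The units pullback of an `SU(2)` torus field and its plaquette dictionary -/

/-- Functoriality of (9): a monoid homomorphism into a group passes through parallel transport, `f(V)(Γ) = f(V(Γ))` (the `ℤ^d` twin of
✓`Prop7CombTowerCentral.hol_map`, reproved here to keep the import light). [cite: Balaban1985Averaging, (9) p.18] -/
theorem hol_monoidHom_apply {d : ℕ} {G H : Type*} [Group G] [Group H] (f : G →* H) (V : (Fin d → ℤ) → Fin d → G) :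
    ∀ (x : Fin d → ℤ) (w : List (Letter d)), hol (fun x κ => f (V x κ)) x w = f (hol V x w)
  | x, [] => by rw [B7Prop1Explicit.hol_nil, B7Prop1Explicit.hol_nil, map_one]
  | x, (μ, true) :: w => by
      rw [B7Prop1Explicit.hol_cons, B7Prop1Explicit.hol_cons, B7Prop1Explicit.stepHol_true, B7Prop1Explicit.stepHol_true, hol_monoidHom_apply f V _ w, map_mul]
  | x, (μ, false) :: w => by
      rw [B7Prop1Explicit.hol_cons, B7Prop1Explicit.hol_cons, B7Prop1Explicit.stepHol_false, B7Prop1Explicit.stepHol_false, hol_monoidHom_apply f V _ w,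
        map_mul, map_inv]

/-- ★ **THE UNITS PULLBACK.**  For an `SU(2)` torus field `V` there is `V̂ : ℤ^d → Fin d → (M₂(ℂ))ˣ` (the image of the periodic pullback `pull V` under
`SU(2) → U(2) → (M₂)ˣ`) with: (value) `↑V̂(y,κ) = ↑V⟨castSite y, κ⟩`; (`U1`) every `V̂(y,κ) ∈ U1`; (dictionary) `F^{plaq}V̂(μ,ν;y) = ↑V(∂⟨castSite y, μ, ν⟩)` for
`μ < ν`, `= ↑(V(∂⟨castSite y, ν, μ⟩)⁻¹)` for `ν < μ`, `= 1` for `μ = ν`. [cite: Balaban1985Averaging, (9) p.18, (19) p.21] -/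
theorem exists_unitsPull (V : GaugeField P j (Matrix.specialUnitaryGroup (Fin 2) ℂ)) :
    ∃ Vh : Zd P.d → Fin P.d → (Matrix (Fin 2) (Fin 2) ℂ)ˣ,
      (∀ y κ, ((Vh y κ : (Matrix (Fin 2) (Fin 2) ℂ)ˣ) : Matrix (Fin 2) (Fin 2) ℂ) =
        ((V ⟨castSite y, κ⟩ : Matrix.specialUnitaryGroup (Fin 2) ℂ) : Matrix (Fin 2) (Fin 2) ℂ)) ∧
      (∀ y κ, Vh y κ ∈ U1 (Matrix (Fin 2) (Fin 2) ℂ)) ∧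
      (∀ y (μ ν : Fin P.d) (h : μ < ν), plaqF Vh μ ν y =
        ((GaugeField.plaqHol V ⟨castSite y, μ, ν, h⟩ : Matrix.specialUnitaryGroup (Fin 2) ℂ) : Matrix (Fin 2) (Fin 2) ℂ)) ∧
      (∀ y (μ ν : Fin P.d) (h : ν < μ), plaqF Vh μ ν y =
        (((GaugeField.plaqHol V ⟨castSite y, ν, μ, h⟩)⁻¹ : Matrix.specialUnitaryGroup (Fin 2) ℂ) : Matrix (Fin 2) (Fin 2) ℂ)) ∧
      (∀ y (μ : Fin P.d), plaqF Vh μ μ y = 1) := by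
  set φ : Matrix.specialUnitaryGroup (Fin 2) ℂ →* (Matrix (Fin 2) (Fin 2) ℂ)ˣ := Unitary.toUnits.comp (suIncl (N := 2)) with hφ
  have hφval : ∀ g : Matrix.specialUnitaryGroup (Fin 2) ℂ, ((φ g : (Matrix (Fin 2) (Fin 2) ℂ)ˣ) : Matrix (Fin 2) (Fin 2) ℂ) =
      (g : Matrix (Fin 2) (Fin 2) ℂ) := fun g => rfl
  refine ⟨fun y κ => φ (pull V y κ), fun y κ => hφval _, fun y κ => mem_U1_of_val_eq_coe _ (V ⟨castSite y, κ⟩) (hφval _), ?_, ?_, ?_⟩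
  · intro y μ ν h
    unfold plaqF
    rw [hol_monoidHom_apply φ (pull V) y (plaqWord μ ν), hφval, hol_pull_plaqWord_of_lt V y h]
  · intro y μ ν h
    unfold plaqF
    rw [hol_monoidHom_apply φ (pull V) y (plaqWord μ ν), hφval, hol_pull_plaqWord_of_gt V y h]
  · intro y μ
    unfold plaqF
    rw [hol_monoidHom_apply φ (pull V) y (plaqWord μ μ), CurvGradAxial.hol_plaqWord_eq]
    simp

/-! ## §2 The antisymmetrised Pauli read-out IS the read plaquette field of the pullback -/

/-- ★ **`F̂^α = λ_α(F^{plaq}V̂ − 1)` AT EVERY INDEX PAIR.**  Given the pen's two rows for `F̂^α` (the `μ < ν` row = the Pauli trace of `V(∂⟨castSite y, μ, ν⟩) − 1`,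
and antisymmetry), a functional `λ` with `λ X = Re tr((iσ_α)X)`, and a pullback `V̂` with the three dictionary rows of `exists_unitsPull`:
`F̂^α(y,μ,ν) = λ(F^{plaq}V̂(μ,ν;y) − 1)` for all `y, μ, ν` (`ν < μ`: ✓`re_trace_pauli_mul_inv_sub_one`; `μ = ν`: both sides vanish). [cite: Balaban1985Averaging, (19)–(20) p.21] -/
theorem readout_eq_read_plaqF (V : GaugeField P j (Matrix.specialUnitaryGroup (Fin 2) ℂ)) (α : Fin 3)
    (lam : Matrix (Fin 2) (Fin 2) ℂ →L[ℝ] ℝ) (hlam : ∀ X, lam X = ((I • pauli α) * X).trace.re)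
    (Vh : Zd P.d → Fin P.d → (Matrix (Fin 2) (Fin 2) ℂ)ˣ)
    (hlt : ∀ y (μ ν : Fin P.d) (h : μ < ν), plaqF Vh μ ν y =
      ((GaugeField.plaqHol V ⟨castSite y, μ, ν, h⟩ : Matrix.specialUnitaryGroup (Fin 2) ℂ) : Matrix (Fin 2) (Fin 2) ℂ))
    (hgt : ∀ y (μ ν : Fin P.d) (h : ν < μ), plaqF Vh μ ν y =
      (((GaugeField.plaqHol V ⟨castSite y, ν, μ, h⟩)⁻¹ : Matrix.specialUnitaryGroup (Fin 2) ℂ) : Matrix (Fin 2) (Fin 2) ℂ))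
    (hself : ∀ y (μ : Fin P.d), plaqF Vh μ μ y = 1)
    (Fh : Zd P.d → Fin P.d → Fin P.d → ℝ)
    (hFh : ∀ y (μ ν : Fin P.d) (h : μ < ν), Fh y μ ν =
      ((I • pauli α) * (((GaugeField.plaqHol V ⟨castSite y, μ, ν, h⟩ : Matrix.specialUnitaryGroup (Fin 2) ℂ) :
        Matrix (Fin 2) (Fin 2) ℂ) - 1)).trace.re)
    (hFha : ∀ y μ ν, Fh y ν μ = -Fh y μ ν) :
    ∀ y μ ν, Fh y μ ν = lam (plaqF Vh μ ν y - 1) := by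
  intro y μ ν
  rcases lt_trichotomy μ ν with h | h | h
  · rw [hFh y μ ν h, hlam, hlt y μ ν h]
  · subst h
    have h0 : Fh y μ μ = 0 := by have := hFha y μ μ; linarith
    rw [h0, hself, sub_self, map_zero]
  · rw [hFha y ν μ, hFh y ν μ h, hlam, hgt y μ ν h, re_trace_pauli_mul_inv_sub_one]

/-! ## §3 The Bianchi term, support-agnostic edition -/

/-- ★★ **KNIT-E3, SUPPORT-AGNOSTIC — THE BIANCHI (BULK) TERM.**  `β` antisymmetric in `(μ,ν)` with cube derivative `γ = d₂β`, a cutoff `0 ≤ χ ≤ 1` vanishing off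
`Q_{S−2}(z) ⊆ Q_{R′}(z)`, `V` an `SU(2)` field with `‖↑V⟨castSite x,κ⟩ − 1‖ ≤ η` for `x ∈ Q_S(z)`, `0 ≤ η`, `4η ≤ 1`, and `F̂^α` the antisymmetrised Pauli read-out
(two rows).  Then
`|Σ_{y∈Q_{R′}(z)} Σ_κΣ_μΣ_ν (χ(y)·γ(y,κ,μ,ν))·(F̂^α(y+e_κ,μ,ν) − F̂^α(y,μ,ν))| ≤ 1312·η²·Σ_{y∈Q_{S−2}(z)} Σ_κΣ_μΣ_ν |γ(y,κ,μ,ν)|`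
(✓`abs_bulk_le` at the read Bianchi bound `|d₂F̂^α| ≤ ‖λ_α‖·984η² ≤ 4·984η²` of ✓`abs_dTwo_read_le_on_box`; `4·984∕3 = 1312`). [cite: GrossCMP1983, Thm 2.2] -/
theorem bianchi_term_le (V : GaugeField P j (Matrix.specialUnitaryGroup (Fin 2) ℂ)) (α : Fin 3)
    (β : Zd P.d → Fin P.d → Fin P.d → ℝ) (γ : Zd P.d → Fin P.d → Fin P.d → Fin P.d → ℝ) (χ : Zd P.d → ℝ) (z : Zd P.d) (S R' : ℤ)
    (hγ : ∀ x κ μ ν, γ x κ μ ν = (β (x + unitVec κ) μ ν - β x μ ν) - (β (x + unitVec μ) κ ν - β x κ ν) + (β (x + unitVec ν) κ μ - β x κ μ))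
    (hβanti : ∀ x μ ν, β x ν μ = -β x μ ν) (hχ01 : ∀ x, 0 ≤ χ x ∧ χ x ≤ 1) (hχ0 : ∀ x, x ∉ box z (S - 2) → χ x = 0) (hSR' : S - 2 ≤ R')
    {η : ℝ} (hη0 : 0 ≤ η) (hη4 : 4 * η ≤ 1)
    (hV : ∀ x ∈ box z S, ∀ κ, ‖((V ⟨castSite x, κ⟩ : Matrix.specialUnitaryGroup (Fin 2) ℂ) : Matrix (Fin 2) (Fin 2) ℂ) - 1‖ ≤ η)
    (Fh : Zd P.d → Fin P.d → Fin P.d → ℝ)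
    (hFh : ∀ y (μ ν : Fin P.d) (h : μ < ν), Fh y μ ν =
      ((I • pauli α) * (((GaugeField.plaqHol V ⟨castSite y, μ, ν, h⟩ : Matrix.specialUnitaryGroup (Fin 2) ℂ) :
        Matrix (Fin 2) (Fin 2) ℂ) - 1)).trace.re)
    (hFha : ∀ y μ ν, Fh y ν μ = -Fh y μ ν) :
    |∑ y ∈ box z R', ∑ κ, ∑ μ, ∑ ν, (χ y * γ y κ μ ν) * (Fh (y + unitVec κ) μ ν - Fh y μ ν)|
      ≤ 1312 * η ^ 2 * ∑ y ∈ box z (S - 2), ∑ κ, ∑ μ, ∑ ν, |γ y κ μ ν| := by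
  classical
  -- the Pauli reading functional and the units pullback
  obtain ⟨lam, hlam, hlam4⟩ := exists_pauliRead α
  obtain ⟨Vh, hval, hU1, hlt, hgt, hself⟩ := exists_unitsPull V
  -- the read-out is the read plaquette field; its alternating cube derivative
  have hF : ∀ x μ ν, Fh x μ ν = lam (plaqF Vh μ ν x - 1) := readout_eq_read_plaqF V α lam hlam Vh hlt hgt hself Fh hFh hFha
  obtain ⟨dF, hdF⟩ : ∃ dF : Zd P.d → Fin P.d → Fin P.d → Fin P.d → ℝ, ∀ x κ μ ν,
      dF x κ μ ν = (Fh (x + unitVec κ) μ ν - Fh x μ ν) - (Fh (x + unitVec μ) κ ν - Fh x κ ν) + (Fh (x + unitVec ν) κ μ - Fh x κ μ) :=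
    ⟨_, fun _ _ _ _ => rfl⟩
  -- bond smallness of the pullback on `Q_S(z)`
  have hsmall : ∀ y ∈ box z S, ∀ κ, ‖((Vh y κ : (Matrix (Fin 2) (Fin 2) ℂ)ˣ) : Matrix (Fin 2) (Fin 2) ℂ) - 1‖ ≤ η := fun y hy κ => by
    rw [hval]; exact hV y hy κ
  -- ✓KNIT-A∕C: the read Bianchi defect on `Q_{S−2}(z)`
  have hB := abs_dTwo_read_le_on_box Vh hU1 z S hη0 hη4 hsmall lam Fh hF dF hdF
  have hB' : ∀ y ∈ box z (S - 2), ∀ κ μ ν, |dF y κ μ ν| ≤ 4 * (984 * η ^ 2) := fun y hy κ μ ν =>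
    (hB y hy κ μ ν).trans (mul_le_mul_of_nonneg_right hlam4 (by positivity))
  -- ✓(Z-a)∕(Z-e): the bulk pairing is one third of the `d₂`-pairing
  have h := abs_bulk_le β γ χ z (S - 2) R' hγ hβanti hχ01 hχ0 hSR' Fh dF hdF hB'
  refine h.trans (le_of_eq ?_)
  ring

/-! ## §4 The Bianchi term in the pen's dressing-box context -/

/-- ★★★ **KNIT-E3 — THE BIANCHI TERM OF (P4), ONE REAL INEQUALITY, IN THE PEN's LETTERS.**  On the `θ`-small dressing box (`PlaqSmallOn (boxPlaqs lo hi) θ U`,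
`hi ≤ lo + n`, `n < sitesPerDir`, `lo = z₀ − (3R+2)`, `hi = z₀ + (3R+4)`), with `V := U^{axialGauge U lo hi}` (bonds within `(d−1)nθ` of `1`,
✓`norm_gaugeAct_axialGauge_sub_one_le`; window `4·(d−1)nθ ≤ 1`), the Green potential `βt` (antisymmetric in `(μ,ν)`), its cube derivative `γt = d₂βt`
(skeleton letter `hγt`), the cutoff `χ ∈ [0,1]` vanishing off `Q_{3R}(z₀)` (`hχ01`, `hχ0'`), and the antisymmetrised Pauli read-out `F̂^α` (two rows):
`|Σ_{y∈Q_{3R+2}(z₀)}Σ_κΣ_μΣ_ν (χγt)·(F̂^α(y+e_κ,μ,ν) − F̂^α(y,μ,ν))| ≤ 1312·((d−1)nθ)²·Σ_{y∈Q_{3R}(z₀)}Σ_κΣ_μΣ_ν|γt(y,κ,μ,ν)|`.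
[cite: GrossCMP1983, Thm 2.2] [cite: Balaban1985Averaging, (19) p.21] -/
theorem bianchi_term_le_of_letters (U : GaugeField P j (Matrix.specialUnitaryGroup (Fin 2) ℂ)) {lo hi : Fin P.d → ℤ} {θ : ℝ} {n : ℕ}
    (hU : PlaqSmallOn (boxPlaqs lo hi) θ U) (hθ : 0 ≤ θ) (hn : ∀ κ, hi κ ≤ lo κ + n) (hnN : n < P.sitesPerDir j)
    (hsmall4 : 4 * (((P.d - 1 : ℕ) : ℝ) * n * θ) ≤ 1) (z₀ : Zd P.d) (R : ℕ)
    (hlo : ∀ κ, lo κ = z₀ κ - (3 * (R : ℤ) + 2)) (hhi : ∀ κ, hi κ = z₀ κ + (3 * (R : ℤ) + 4))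
    (βt : Zd P.d → Fin P.d → Fin P.d → ℝ) (γt : Zd P.d → Fin P.d → Fin P.d → Fin P.d → ℝ) (χ : Zd P.d → ℝ)
    (hβanti : ∀ x μ ν, βt x ν μ = -βt x μ ν)
    (hγt : ∀ x κ μ ν, γt x κ μ ν = (βt (x + unitVec κ) μ ν - βt x μ ν) - (βt (x + unitVec μ) κ ν - βt x κ ν) + (βt (x + unitVec ν) κ μ - βt x κ μ))
    (hχ01 : ∀ x, 0 ≤ χ x ∧ χ x ≤ 1) (hχ0 : ∀ x, x ∉ box z₀ (3 * (R : ℤ)) → χ x = 0)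
    (α : Fin 3) (Fh : Zd P.d → Fin P.d → Fin P.d → ℝ)
    (hFh : ∀ y (μ ν : Fin P.d) (h : μ < ν), Fh y μ ν =
      ((I • pauli α) * (((GaugeField.plaqHol (GaugeField.gaugeAct (axialGauge U lo hi) U) ⟨castSite y, μ, ν, h⟩ :
        Matrix.specialUnitaryGroup (Fin 2) ℂ) : Matrix (Fin 2) (Fin 2) ℂ) - 1)).trace.re)
    (hFha : ∀ y μ ν, Fh y ν μ = -Fh y μ ν) :
    |∑ y ∈ box z₀ (3 * (R : ℤ) + 2), ∑ κ, ∑ μ, ∑ ν, (χ y * γt y κ μ ν) * (Fh (y + unitVec κ) μ ν - Fh y μ ν)|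
      ≤ 1312 * (((P.d - 1 : ℕ) : ℝ) * n * θ) ^ 2 * ∑ y ∈ box z₀ (3 * (R : ℤ)), ∑ κ, ∑ μ, ∑ ν, |γt y κ μ ν| := by
  have hη0 : 0 ≤ ((P.d - 1 : ℕ) : ℝ) * n * θ := by positivity
  -- the bonds `⟨castSite x, κ⟩`, `x ∈ Q_{3R+2}(z₀)`, lie in the dressing box, so the axial gauge makes them `(d−1)nθ`-small
  have hmem : ∀ {x : Zd P.d}, x ∈ box z₀ (3 * (R : ℤ) + 2) → ∀ κ : Fin P.d, (⟨castSite x, κ⟩ : PBond P j) ∈ boxBonds lo hi := by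
    intro x hx κ
    refine ⟨x, fun i => ?_, fun i => ?_, rfl⟩
    · have h := (mem_box.mp hx) i
      rw [abs_le] at h
      rw [hlo i]; linarith [h.1]
    · have h := (mem_box.mp hx) i
      rw [abs_le] at h
      have hu : (e κ : Zd P.d) i ≤ 1 := le_trans (le_abs_self _) (abs_unitVec_apply_le κ i)
      simp only [Pi.add_apply, hhi i]
      linarith [h.2]
  have hV : ∀ x ∈ box z₀ (3 * (R : ℤ) + 2), ∀ κ,
      ‖((GaugeField.gaugeAct (axialGauge U lo hi) U ⟨castSite x, κ⟩ : Matrix.specialUnitaryGroup (Fin 2) ℂ) : Matrix (Fin 2) (Fin 2) ℂ) - 1‖ ≤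
        ((P.d - 1 : ℕ) : ℝ) * n * θ := fun x hx κ =>
    norm_gaugeAct_axialGauge_sub_one_le U hU hθ hn hnN (hmem hx κ)
  have hχ0' : ∀ x, x ∉ box z₀ (3 * (R : ℤ) + 2 - 2) → χ x = 0 := fun x hx =>
    hχ0 x (by rwa [show 3 * (R : ℤ) + 2 - 2 = 3 * (R : ℤ) by ring] at hx)
  have h := bianchi_term_le (GaugeField.gaugeAct (axialGauge U lo hi) U) α βt γt χ z₀ (3 * (R : ℤ) + 2) (3 * (R : ℤ) + 2) hγt hβanti hχ01 hχ0'
    (by linarith) hη0 hsmall4 hV Fh hFh hFha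
  rwa [show 3 * (R : ℤ) + 2 - 2 = 3 * (R : ℤ) by ring] at h

/-- **KNIT-E3 CLOSER — WITH THE BULK-MASS ROW AS A HYPOTHESIS.**  Same context; if the (Z-e) bulk-mass row `Σ_{y∈Q_{3R}(z₀)}ΣΣΣ|γt| ≤ Mγ` is supplied
(✓`CovariantDischargeGreenPotentialShell.bulk_mass_le` at `d = 3`: `Mγ = (81∕2)·(Σ_e|K_e(0)| + 26·C₁·(3R+ℓ0))·M₀`), the Bianchi term is at most `1312·((d−1)nθ)²·Mγ`.
[cite: GrossCMP1983, Thm 2.2] -/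
theorem bianchi_term_le_of_letters_of_mass (U : GaugeField P j (Matrix.specialUnitaryGroup (Fin 2) ℂ)) {lo hi : Fin P.d → ℤ} {θ : ℝ} {n : ℕ}
    (hU : PlaqSmallOn (boxPlaqs lo hi) θ U) (hθ : 0 ≤ θ) (hn : ∀ κ, hi κ ≤ lo κ + n) (hnN : n < P.sitesPerDir j)
    (hsmall4 : 4 * (((P.d - 1 : ℕ) : ℝ) * n * θ) ≤ 1) (z₀ : Zd P.d) (R : ℕ)
    (hlo : ∀ κ, lo κ = z₀ κ - (3 * (R : ℤ) + 2)) (hhi : ∀ κ, hi κ = z₀ κ + (3 * (R : ℤ) + 4))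
    (βt : Zd P.d → Fin P.d → Fin P.d → ℝ) (γt : Zd P.d → Fin P.d → Fin P.d → Fin P.d → ℝ) (χ : Zd P.d → ℝ)
    (hβanti : ∀ x μ ν, βt x ν μ = -βt x μ ν)
    (hγt : ∀ x κ μ ν, γt x κ μ ν = (βt (x + unitVec κ) μ ν - βt x μ ν) - (βt (x + unitVec μ) κ ν - βt x κ ν) + (βt (x + unitVec ν) κ μ - βt x κ μ))
    (hχ01 : ∀ x, 0 ≤ χ x ∧ χ x ≤ 1) (hχ0 : ∀ x, x ∉ box z₀ (3 * (R : ℤ)) → χ x = 0)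
    {Mγ : ℝ} (hmass : ∑ y ∈ box z₀ (3 * (R : ℤ)), ∑ κ, ∑ μ, ∑ ν, |γt y κ μ ν| ≤ Mγ)
    (α : Fin 3) (Fh : Zd P.d → Fin P.d → Fin P.d → ℝ)
    (hFh : ∀ y (μ ν : Fin P.d) (h : μ < ν), Fh y μ ν =
      ((I • pauli α) * (((GaugeField.plaqHol (GaugeField.gaugeAct (axialGauge U lo hi) U) ⟨castSite y, μ, ν, h⟩ :
        Matrix.specialUnitaryGroup (Fin 2) ℂ) : Matrix (Fin 2) (Fin 2) ℂ) - 1)).trace.re)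
    (hFha : ∀ y μ ν, Fh y ν μ = -Fh y μ ν) :
    |∑ y ∈ box z₀ (3 * (R : ℤ) + 2), ∑ κ, ∑ μ, ∑ ν, (χ y * γt y κ μ ν) * (Fh (y + unitVec κ) μ ν - Fh y μ ν)|
      ≤ 1312 * (((P.d - 1 : ℕ) : ℝ) * n * θ) ^ 2 * Mγ :=
  (bianchi_term_le_of_letters U hU hθ hn hnN hsmall4 z₀ R hlo hhi βt γt χ hβanti hγt hχ01 hχ0 α Fh hFh hFha).trans
    (mul_le_mul_of_nonneg_left hmass (by positivity))

end Summit.QuantumFields.YangMills.Theorems.GrossTransferStubLinTestBianchiTerm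

end
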